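import Summits.QuantumFields.YangMills.Theorems.F4SubCurvatureDoorForwardConeLukacsOneDim
import Mathlib
import HarnessLib

/-!
# Lukacs / Vivanti–Pringsheim in one dimension: EXACT even moments and exponential moments up to the FULL radius (S1 programme, crux ⟨stmt-QuantumFields-23125⟩)

Free-hands helper of width seat `ym-line-sfw-p2-w3` (g37, cell `ym-idea-1`), sharpening the rung R-S1ℓ `LukacsOneDim` file
(`…ForwardConeLukacsOneDim.lean`, SOME `δ > 0`) to the full strip, which is the one-dimensional core of the owner's rung
«PRINGSHEIM IDENTIFICATION» (`ForwardConeRungs.PringsheimIdentification`): if the cosine transform `φ(s) = ∫ cos(sq) dm` of a finite positive measure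
has a power series `Σ aₙ sⁿ` on `|s| < r`, then

* `integral_pow_eq_coeff` — the even moments are EXACTLY `∫ q^{2k} dm = (−1)^k (2k)! a_{2k}` (derivative-free: the `2k`-th symmetric difference is
  `(2k)! a_{2k} h^{2k} + O(h^{2k+1})` (`abs_symmDiff_sub_le_of_hasFPowerSeriesOnBall`), while `h^{−2k} ∫ (2 − 2cos(hq))^k dm → ∫ q^{2k} dm` by
  DOMINATED convergence, the domination `(q sinc(hq/2))^{2k} ≤ q^{2k}` being integrable by the Fatou step of the rung file);
* `expMoment_of_hasFPowerSeriesOnBall` — for EVERY `0 < δ < r`: `q ↦ e^{δ|q|}` is `m`-integrable and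
  `∫ cosh(δq) dm = Σ_k (−1)^k a_{2k} δ^{2k}` (Tonelli), i.e. the exponential moments exist up to the radius of convergence and are read off the
  Taylor coefficients (Vivanti–Pringsheim for cosine transforms).

HONEST LABEL: classical one-dimensional analysis toward OPEN rungs; S1, ⟨23125⟩, ⟨23035⟩ and R2d stay OPEN; the Yang–Mills mass gap is NOT proved.
-/

set_option autoImplicit false

noncomputable section

namespace Summit.QuantumFields.YangMills.Theorems.F4SubCurvatureDoorForwardConeLukacs

open Finset MeasureTheory Filter
open scoped BigOperators Real Topology ENNReal

/-! ## First-order asymptotics of the symmetric differences -/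

/-- Quantitative `2k`-th symmetric difference: with `φ = Σ aₙ yⁿ` on `|y| < r`, `‖pₙ‖ρⁿ ≤ C`, `k ≥ 1`, `0 < h ≤ ρ/(2k)`:
`|Σ_{j≤2k} (−1)^j C(2k,j) φ((j − k)h) − (2k)!·a_{2k}·h^{2k}| ≤ 2C·4^k·(kh/ρ)^{2k+1}`. -/
theorem abs_symmDiff_sub_le_of_hasFPowerSeriesOnBall {φ : ℝ → ℝ} {p : FormalMultilinearSeries ℝ ℝ ℝ} {r : ℝ≥0∞}
    (hφ : HasFPowerSeriesOnBall φ p 0 r) {ρ C : ℝ} (hρ : 0 < ρ) (hρr : ENNReal.ofReal ρ < r)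
    (hC : ∀ n, ‖p n‖ * ρ ^ n ≤ C) (k : ℕ) (hk : 1 ≤ k) {h : ℝ} (hh : 0 < h) (hhk : h ≤ ρ / (2 * k)) :
    |∑ j ∈ range (2 * k + 1), (-1 : ℝ) ^ j * ((2 * k).choose j : ℝ) * φ (((j : ℝ) - k) * h) -
        ((2 * k).factorial : ℝ) * p.coeff (2 * k) * h ^ (2 * k)| ≤
      2 * C * 4 ^ k * (k * h / ρ) ^ (2 * k + 1) := by
  have hkpos : (0 : ℝ) < k := by exact_mod_cast hk
  have hC0 : 0 ≤ C := by
    have h0 := hC 0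
    rw [pow_zero, mul_one] at h0
    exact (norm_nonneg _).trans h0
  set a : ℕ → ℝ := fun n => p.coeff n with ha_def
  have ha : ∀ n, |a n| ≤ C / ρ ^ n := fun n => by
    rw [le_div_iff₀ (pow_pos hρ n), ha_def]
    simpa [FormalMultilinearSeries.norm_apply_eq_norm_coef, Real.norm_eq_abs] using hC n
  set t : ℝ := k * h / ρ with ht_def
  have ht0 : 0 ≤ t := by positivity
  have ht : t ≤ 1 / 2 := by
    rw [ht_def, div_le_iff₀ hρ]
    have := (le_div_iff₀ (by positivity : (0 : ℝ) < 2 * k)).1 hhk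
    linarith
  have ht1 : t < 1 := by linarith
  have hexp : ∀ j ∈ range (2 * k + 1),
      HasSum (fun n => a n * (((j : ℝ) - k) * h) ^ n) (φ (((j : ℝ) - k) * h)) := by
    intro j hj
    have hjle : (j : ℝ) ≤ 2 * k := by exact_mod_cast Nat.lt_succ_iff.1 (mem_range.1 hj)
    have habs : |((j : ℝ) - k) * h| ≤ ρ / 2 := by
      rw [abs_mul, abs_of_pos hh]
      have h1 : |(j : ℝ) - k| ≤ k := by rw [abs_le]; constructor <;> linarith [(Nat.cast_nonneg j : (0 : ℝ) ≤ j)]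
      calc |(j : ℝ) - k| * h ≤ k * h := mul_le_mul_of_nonneg_right h1 hh.le
        _ ≤ k * (ρ / (2 * k)) := mul_le_mul_of_nonneg_left hhk hkpos.le
        _ = ρ / 2 := by field_simp
    have hy : (((j : ℝ) - k) * h) ∈ Metric.eball (0 : ℝ) r := by
      rw [Metric.mem_eball, edist_zero_right, ← ofReal_norm, Real.norm_eq_abs]
      exact lt_of_le_of_lt (ENNReal.ofReal_le_ofReal (by linarith)) hρr
    have hs := hφ.hasSum hy
    rw [zero_add] at hs
    refine hs.congr_fun fun n => ?_
    rw [FormalMultilinearSeries.apply_eq_pow_smul_coeff, smul_eq_mul, mul_comm]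
  set S : ℕ → ℝ := fun n => ∑ j ∈ range (2 * k + 1), (-1 : ℝ) ^ j * ((2 * k).choose j : ℝ) * ((j : ℝ) - k) ^ n
    with hS_def
  set T : ℕ → ℝ := fun n => a n * h ^ n * S n with hT_def
  have hT : HasSum T (∑ j ∈ range (2 * k + 1), (-1 : ℝ) ^ j * ((2 * k).choose j : ℝ) * φ (((j : ℝ) - k) * h)) := by
    have h1 := hasSum_sum fun j hj => (hexp j hj).mul_left ((-1 : ℝ) ^ j * ((2 * k).choose j : ℝ))
    refine h1.congr_fun fun n => ?_
    simp only [hT_def, hS_def, Finset.mul_sum]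
    refine Finset.sum_congr rfl fun j _ => ?_
    rw [mul_pow]; ring
  have hT0 : ∀ n, n < 2 * k → T n = 0 := fun n hn => by
    simp only [hT_def, hS_def, symmDiff_pow_eq_zero k n hn, mul_zero]
  -- the leading term `T (2k) = (2k)! a_{2k} h^{2k}`
  have hT2k : T (2 * k) = ((2 * k).factorial : ℝ) * p.coeff (2 * k) * h ^ (2 * k) := by
    simp only [hT_def, hS_def, symmDiff_pow_eq_factorial k, ha_def]
    ring
  -- shift by `2k + 1`
  have hshift : HasSum (fun n => T (n + (2 * k + 1)))
      (∑ j ∈ range (2 * k + 1), (-1 : ℝ) ^ j * ((2 * k).choose j : ℝ) * φ (((j : ℝ) - k) * h) -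
        ((2 * k).factorial : ℝ) * p.coeff (2 * k) * h ^ (2 * k)) := by
    have := (hasSum_nat_add_iff' (f := T) (2 * k + 1)).2 hT
    rwa [Finset.sum_range_succ T (2 * k), Finset.sum_eq_zero (fun i hi => hT0 i (mem_range.1 hi)), zero_add,
      hT2k] at this
  have hTle : ∀ n, ‖T (n + (2 * k + 1))‖ ≤ C * 4 ^ k * t ^ (2 * k + 1) * t ^ n := by
    intro n
    rw [Real.norm_eq_abs, hT_def]
    simp only
    rw [abs_mul, abs_mul, abs_pow, abs_of_pos hh]
    have h1 := ha (n + (2 * k + 1))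
    have h2 := abs_symmDiff_pow_le k (n + (2 * k + 1))
    calc |a (n + (2 * k + 1))| * h ^ (n + (2 * k + 1)) * |S (n + (2 * k + 1))|
        ≤ (C / ρ ^ (n + (2 * k + 1))) * h ^ (n + (2 * k + 1)) * ((4 : ℝ) ^ k * (k : ℝ) ^ (n + (2 * k + 1))) := by
          gcongr
      _ = C * 4 ^ k * t ^ (2 * k + 1) * t ^ n := by
          rw [ht_def]
          simp only [div_pow, mul_pow]
          ring
  have hgeom : HasSum (fun n => C * 4 ^ k * t ^ (2 * k + 1) * t ^ n) (C * 4 ^ k * t ^ (2 * k + 1) * (1 - t)⁻¹) :=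
    (hasSum_geometric_of_lt_one ht0 ht1).mul_left _
  have hbound := tsum_of_norm_bounded hgeom hTle
  rw [← hshift.tsum_eq]
  refine (Real.norm_eq_abs _ ▸ hbound).trans ?_
  have hinv : (1 - t)⁻¹ ≤ 2 := by
    rw [inv_le_comm₀ (by linarith) (by norm_num)]; linarith
  have hK : 0 ≤ C * 4 ^ k * t ^ (2 * k + 1) := by positivity
  calc C * 4 ^ k * t ^ (2 * k + 1) * (1 - t)⁻¹ ≤ C * 4 ^ k * t ^ (2 * k + 1) * 2 :=
        mul_le_mul_of_nonneg_left hinv hK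
    _ = 2 * C * 4 ^ k * (k * h / ρ) ^ (2 * k + 1) := by rw [ht_def]; ring

/-! ## Exact even moments -/

/-- **Exact even moments** of a finite positive measure whose cosine transform has a power series at `0`:
`q^{2k}` is integrable and `∫ q^{2k} dm = (−1)^k (2k)! a_{2k}`. -/
theorem integral_pow_eq_coeff (m : Measure ℝ) [IsFiniteMeasure m] (φ : ℝ → ℝ)
    (hφ : ∀ s : ℝ, φ s = ∫ q, Real.cos (s * q) ∂m) {p : FormalMultilinearSeries ℝ ℝ ℝ} {r : ℝ≥0∞}
    (hp : HasFPowerSeriesOnBall φ p 0 r) (k : ℕ) :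
    Integrable (fun q : ℝ => q ^ (2 * k)) m ∧
      ∫ q, q ^ (2 * k) ∂m = (-1) ^ k * ((2 * k).factorial : ℝ) * p.coeff (2 * k) := by
  rcases Nat.eq_zero_or_pos k with rfl | hk
  · -- `k = 0`: `∫ 1 dm = φ 0 = a₀`
    simp only [mul_zero, pow_zero, Nat.factorial_zero, Nat.cast_one, one_mul]
    refine ⟨integrable_const _, ?_⟩
    have h0 := hp.coeff_zero (fun _ => 1)
    rw [show p 0 (fun _ => 1) = p.coeff 0 from rfl] at h0
    rw [h0, hφ 0]
    simp
  -- data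
  obtain ⟨ρ, -, hρpos, hρr⟩ := ENNReal.lt_iff_exists_real_btwn.1 hp.r_pos
  have hρ : 0 < ρ := by simpa using hρpos
  obtain ⟨C, -, hC⟩ := p.norm_mul_pow_le_of_lt_radius (r := ρ.toNNReal) (lt_of_lt_of_le hρr hp.r_le)
  have hC' : ∀ n, ‖p n‖ * ρ ^ n ≤ C := fun n => by
    have := hC n; rwa [Real.coe_toNNReal _ hρ.le] at this
  have hC0 : 0 ≤ C := by
    have h0 := hC' 0
    rw [pow_zero, mul_one] at h0
    exact (norm_nonneg _).trans h0
  have hkpos : (0 : ℝ) < k := by exact_mod_cast hk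
  -- trigonometric moments are symmetric differences of `φ`
  have hcos_int : ∀ s : ℝ, Integrable (fun q : ℝ => Real.cos (s * q)) m := fun s =>
    Integrable.of_bound (Continuous.aestronglyMeasurable (by fun_prop)) 1
      (ae_of_all _ fun q => by simpa using Real.abs_cos_le_one (s * q))
  have hInt : ∀ h : ℝ, ∫ q, (2 - 2 * Real.cos (h * q)) ^ k ∂m =
      (-1) ^ k * ∑ j ∈ range (2 * k + 1), (-1 : ℝ) ^ j * ((2 * k).choose j : ℝ) * φ (((j : ℝ) - k) * h) := by
    intro h
    have h1 : (fun q : ℝ => (2 - 2 * Real.cos (h * q)) ^ k) = fun q =>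
        (-1) ^ k * ∑ j ∈ range (2 * k + 1), (-1 : ℝ) ^ j * ((2 * k).choose j : ℝ) * Real.cos ((((j : ℝ) - k) * h) * q) := by
      funext q
      rw [two_sub_two_cos_pow_eq_sum]
      congr 1
      refine Finset.sum_congr rfl fun j _ => ?_
      rw [mul_assoc ((j : ℝ) - k) h q]
    rw [h1, integral_const_mul, integral_finsetSum _ fun j _ => (hcos_int _).const_mul _]
    congr 1
    refine Finset.sum_congr rfl fun j _ => ?_
    rw [integral_const_mul, hφ]
  -- integrability of `q^{2k}` (Fatou step of the rung file)
  have hB : ∀ h : ℝ, 0 < h → h < ρ / (2 * k) →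
      ∫ q, (2 - 2 * Real.cos (h * q)) ^ k ∂m ≤ (2 * C * (2 * k / ρ) ^ (2 * k)) * h ^ (2 * k) := by
    intro h hh hhk
    rw [hInt]
    have h1 := abs_symmDiff_le_of_hasFPowerSeriesOnBall hp hρ hρr hC' k hk hh hhk.le
    refine le_trans ?_ h1
    refine (le_abs_self _).trans (le_of_eq ?_)
    rw [abs_mul, abs_pow, abs_neg, abs_one, one_pow, one_mul]
  have hint : Integrable (fun q : ℝ => q ^ (2 * k)) m :=
    (integrable_pow_of_symmDiff_bound m k (h₀ := ρ / (2 * k)) (by positivity) hB).1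
  refine ⟨hint, ?_⟩
  -- the sequence `hₙ = h₀/(n+2)`, `h₀ = ρ/(2k)`
  set h₀ : ℝ := ρ / (2 * k) with hh₀_def
  have hh₀ : 0 < h₀ := by positivity
  set hs : ℕ → ℝ := fun n => h₀ / ((n : ℝ) + 2) with hs_def
  have hs_pos : ∀ n, 0 < hs n := fun n => div_pos hh₀ (by positivity)
  have hs_le : ∀ n, hs n ≤ h₀ := fun n => by
    rw [hs_def]
    exact div_le_self hh₀.le (by linarith [(Nat.cast_nonneg n : (0 : ℝ) ≤ n)])
  have hs_tendsto : Tendsto hs atTop (𝓝 0) := by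
    have h1 := (tendsto_add_atTop_iff_nat 2).2 (tendsto_const_div_atTop_nhds_zero_nat h₀)
    refine h1.congr fun n => ?_
    simp [hs_def, Nat.cast_add]
  -- regularised integrands
  set g : ℕ → ℝ → ℝ := fun n q => (q * Real.sinc (hs n * q / 2)) ^ (2 * k) with hg_def
  have hg_cont : ∀ n, Continuous (g n) := fun n => by
    simp only [hg_def]
    exact ((continuous_id.mul (Real.continuous_sinc.comp ((continuous_const.mul continuous_id).div_const _))).pow _)
  -- (A1) dominated convergence: `∫ gₙ → ∫ q^{2k}`
  have hA1 : Tendsto (fun n => ∫ q, g n q ∂m) atTop (𝓝 (∫ q, q ^ (2 * k) ∂m)) := by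
    refine tendsto_integral_of_dominated_convergence (fun q : ℝ => q ^ (2 * k))
      (fun n => (hg_cont n).aestronglyMeasurable) hint (fun n => ae_of_all _ fun q => ?_) (ae_of_all _ fun q => ?_)
    · rw [Real.norm_eq_abs, hg_def]
      simp only
      rw [abs_pow, abs_mul, show q ^ (2 * k) = |q| ^ (2 * k) by rw [pow_mul, pow_mul, sq_abs]]
      refine pow_le_pow_left₀ (by positivity) ?_ _
      have := Real.abs_sinc_le_one (hs n * q / 2)
      have hq := abs_nonneg q
      nlinarith
    · have h1 : Tendsto (fun n => hs n * q / 2) atTop (𝓝 0) := by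
        simpa using (hs_tendsto.mul_const q).div_const 2
      have h2 : Tendsto (fun n => Real.sinc (hs n * q / 2)) atTop (𝓝 1) := by
        rw [← Real.sinc_zero]
        exact (Real.continuous_sinc.tendsto 0).comp h1
      simpa [hg_def] using ((tendsto_const_nhds (x := q)).mul h2).pow (2 * k)
  -- (A2) the series side: `∫ gₙ → (−1)^k (2k)! a_{2k}`
  have hA2 : Tendsto (fun n => ∫ q, g n q ∂m) atTop (𝓝 ((-1) ^ k * ((2 * k).factorial : ℝ) * p.coeff (2 * k))) := by
    have hK : ∀ n, |∫ q, g n q ∂m - (-1) ^ k * ((2 * k).factorial : ℝ) * p.coeff (2 * k)| ≤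
        (2 * C * 4 ^ k * (k / ρ) ^ (2 * k + 1)) * hs n := by
      intro n
      have h1 : ∫ q, g n q ∂m = (hs n ^ (2 * k))⁻¹ * ∫ q, (2 - 2 * Real.cos (hs n * q)) ^ k ∂m := by
        have h2 : (fun q => (2 - 2 * Real.cos (hs n * q)) ^ k) = fun q => hs n ^ (2 * k) * g n q := by
          funext q; rw [two_sub_two_cos_pow_eq_sinc]
        rw [h2, integral_const_mul, ← mul_assoc, inv_mul_cancel₀ (pow_ne_zero _ (hs_pos n).ne'), one_mul]
      have h3 := abs_symmDiff_sub_le_of_hasFPowerSeriesOnBall hp hρ hρr hC' k hk (hs_pos n) (hs_le n)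
      have hpow : 0 < hs n ^ (2 * k) := pow_pos (hs_pos n) _
      rw [h1, hInt]
      have h4 : (hs n ^ (2 * k))⁻¹ * ((-1) ^ k * ∑ j ∈ range (2 * k + 1),
            (-1 : ℝ) ^ j * ((2 * k).choose j : ℝ) * φ (((j : ℝ) - k) * hs n)) -
          (-1) ^ k * ((2 * k).factorial : ℝ) * p.coeff (2 * k) =
          (hs n ^ (2 * k))⁻¹ * (-1) ^ k * (∑ j ∈ range (2 * k + 1),
            (-1 : ℝ) ^ j * ((2 * k).choose j : ℝ) * φ (((j : ℝ) - k) * hs n) -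
            ((2 * k).factorial : ℝ) * p.coeff (2 * k) * hs n ^ (2 * k)) := by
        have hu : (hs n ^ (2 * k))⁻¹ * hs n ^ (2 * k) = 1 := inv_mul_cancel₀ (pow_ne_zero _ (hs_pos n).ne')
        linear_combination ((-1 : ℝ) ^ k * ((2 * k).factorial : ℝ) * p.coeff (2 * k)) * hu
      rw [h4, abs_mul, abs_mul, abs_inv, abs_pow, abs_of_pos (hs_pos n), abs_pow, abs_neg, abs_one, one_pow,
        mul_one]
      calc (hs n ^ (2 * k))⁻¹ * |∑ j ∈ range (2 * k + 1), (-1 : ℝ) ^ j * ((2 * k).choose j : ℝ) * φ (((j : ℝ) - k) * hs n) -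
              ((2 * k).factorial : ℝ) * p.coeff (2 * k) * hs n ^ (2 * k)|
          ≤ (hs n ^ (2 * k))⁻¹ * (2 * C * 4 ^ k * (k * hs n / ρ) ^ (2 * k + 1)) :=
            mul_le_mul_of_nonneg_left h3 (inv_nonneg.2 hpow.le)
        _ = (2 * C * 4 ^ k * (k / ρ) ^ (2 * k + 1)) * hs n := by
            have h5 : ((k : ℝ) * hs n / ρ) ^ (2 * k + 1) = (k / ρ) ^ (2 * k + 1) * (hs n ^ (2 * k) * hs n) := by
              rw [show (k : ℝ) * hs n / ρ = k / ρ * hs n by ring, mul_pow, pow_succ (hs n) (2 * k)]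
            calc (hs n ^ (2 * k))⁻¹ * (2 * C * 4 ^ k * (k * hs n / ρ) ^ (2 * k + 1))
                = (2 * C * 4 ^ k * (k / ρ) ^ (2 * k + 1)) * hs n * ((hs n ^ (2 * k))⁻¹ * hs n ^ (2 * k)) := by
                  rw [h5]; ring
              _ = (2 * C * 4 ^ k * (k / ρ) ^ (2 * k + 1)) * hs n := by
                  rw [inv_mul_cancel₀ (pow_ne_zero _ (hs_pos n).ne'), mul_one]
    have hlim : Tendsto (fun n => (2 * C * 4 ^ k * (k / ρ) ^ (2 * k + 1)) * hs n) atTop (𝓝 0) := by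
      simpa using hs_tendsto.const_mul (2 * C * 4 ^ k * (k / ρ) ^ (2 * k + 1))
    have hsub : Tendsto (fun n => ∫ q, g n q ∂m - (-1) ^ k * ((2 * k).factorial : ℝ) * p.coeff (2 * k)) atTop (𝓝 0) :=
      squeeze_zero_norm (fun n => (Real.norm_eq_abs _).le.trans (hK n)) hlim
    exact tendsto_sub_nhds_zero_iff.1 hsub
  exact tendsto_nhds_unique hA1 hA2

/-! ## Exponential moments up to the full radius (Vivanti–Pringsheim for cosine transforms) -/

/-- **Lukacs / Vivanti–Pringsheim (1-D).**  If the cosine transform `φ(s) = ∫ cos(sq) dm` of a finite positive measure has the power series `p`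
on the ball of radius `r` about `0`, then for every `0 < δ` with `δ < r`: `q ↦ e^{δ|q|}` is `m`-integrable and
`∫ cosh(δq) dm = Σ_k (−1)^k a_{2k} δ^{2k}` (`a = p.coeff`). -/
theorem expMoment_of_hasFPowerSeriesOnBall (m : Measure ℝ) [IsFiniteMeasure m] (φ : ℝ → ℝ)
    (hφ : ∀ s : ℝ, φ s = ∫ q, Real.cos (s * q) ∂m) {p : FormalMultilinearSeries ℝ ℝ ℝ} {r : ℝ≥0∞}
    (hp : HasFPowerSeriesOnBall φ p 0 r) {δ : ℝ} (hδ : 0 < δ) (hδr : ENNReal.ofReal δ < r) :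
    Integrable (fun q : ℝ => Real.exp (δ * |q|)) m ∧
      HasSum (fun k : ℕ => (-1 : ℝ) ^ k * p.coeff (2 * k) * δ ^ (2 * k)) (∫ q, Real.cosh (δ * q) ∂m) := by
  -- a radius `ρ'` with `δ < ρ' < r` and the Cauchy-type bound there
  obtain ⟨ρ', -, hδρ', hρ'r⟩ := ENNReal.lt_iff_exists_real_btwn.1 hδr
  have hρ' : 0 < ρ' := ENNReal.ofReal_pos.1 (lt_of_le_of_lt bot_le hδρ')
  have hδρ : δ < ρ' := (ENNReal.ofReal_lt_ofReal_iff hρ').1 hδρ'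
  obtain ⟨C, -, hC⟩ := p.norm_mul_pow_le_of_lt_radius (r := ρ'.toNNReal) (lt_of_lt_of_le hρ'r hp.r_le)
  have hC' : ∀ n, ‖p n‖ * ρ' ^ n ≤ C := fun n => by
    have := hC n; rwa [Real.coe_toNNReal _ hρ'.le] at this
  have ha : ∀ n, |p.coeff n| ≤ C / ρ' ^ n := fun n => by
    rw [le_div_iff₀ (pow_pos hρ' n)]
    simpa [FormalMultilinearSeries.norm_apply_eq_norm_coef, Real.norm_eq_abs] using hC' n
  -- the moments
  have hMom := fun k => integral_pow_eq_coeff m φ hφ hp k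
  -- the series `F k q = (δ^{2k}/(2k)!) q^{2k}`
  set F : ℕ → ℝ → ℝ := fun k q => (δ ^ (2 * k) / ((2 * k).factorial : ℝ)) * q ^ (2 * k) with hF_def
  have hF_nonneg : ∀ k q, 0 ≤ F k q := fun k q => mul_nonneg (by positivity) ((even_two_mul k).pow_nonneg q)
  have hF_int : ∀ k, Integrable (F k) m := fun k => (hMom k).1.const_mul _
  have hF_val : ∀ k, ∫ q, F k q ∂m = (-1 : ℝ) ^ k * p.coeff (2 * k) * δ ^ (2 * k) := by
    intro k
    have hf : ((2 * k).factorial : ℝ) ≠ 0 := by positivity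
    rw [hF_def]
    simp only
    rw [integral_const_mul, (hMom k).2]
    calc δ ^ (2 * k) / ((2 * k).factorial : ℝ) * ((-1) ^ k * ((2 * k).factorial : ℝ) * p.coeff (2 * k))
        = (-1) ^ k * p.coeff (2 * k) * δ ^ (2 * k) * (((2 * k).factorial : ℝ) / ((2 * k).factorial : ℝ)) := by ring
      _ = (-1) ^ k * p.coeff (2 * k) * δ ^ (2 * k) := by rw [div_self hf, mul_one]
  -- summability of `∫ |F k| = (−1)^k a_{2k} δ^{2k} ≤ C (δ/ρ')^{2k}`
  have hnorm_eq : ∀ k, ∫ q, ‖F k q‖ ∂m = (-1 : ℝ) ^ k * p.coeff (2 * k) * δ ^ (2 * k) := fun k => by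
    rw [← hF_val k]
    exact integral_congr_ae (ae_of_all _ fun q => Real.norm_of_nonneg (hF_nonneg k q))
  have hsumm : Summable fun k => ∫ q, ‖F k q‖ ∂m := by
    refine Summable.of_norm_bounded ((summable_geometric_of_lt_one (by positivity)
      ((sq_lt_one_iff₀ (by positivity)).2 ((div_lt_one hρ').2 hδρ))).mul_left C) fun k => ?_
    rw [hnorm_eq, Real.norm_eq_abs, abs_mul, abs_mul, abs_pow, abs_pow, abs_neg, abs_one, one_pow, one_mul,
      abs_of_pos hδ, ← pow_mul]
    calc |p.coeff (2 * k)| * δ ^ (2 * k) ≤ C / ρ' ^ (2 * k) * δ ^ (2 * k) :=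
          mul_le_mul_of_nonneg_right (ha _) (by positivity)
      _ = C * (δ / ρ') ^ (2 * k) := by rw [div_pow]; field_simp
  -- Tonelli: `Σ ∫ F k = ∫ cosh(δq)`
  have hS := hasSum_integral_of_summable_integral_norm hF_int hsumm
  have hcosh_pt : ∀ q : ℝ, HasSum (fun k => F k q) (Real.cosh (δ * q)) := fun q => by
    refine (Real.hasSum_cosh (δ * q)).congr_fun fun k => ?_
    simp only [hF_def, mul_pow]
    ring
  have hcosh_eq : (fun q : ℝ => ∑' k, F k q) = fun q => Real.cosh (δ * q) := funext fun q => (hcosh_pt q).tsum_eq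
  rw [hcosh_eq] at hS
  refine ⟨?_, hS.congr_fun fun k => (hF_val k).symm⟩
  -- integrability of `e^{δ|q|} ≤ 2cosh(δq)` via Tonelli in `ℝ≥0∞`
  have hc_nonneg : ∀ k, 0 ≤ 2 * ∫ q, F k q ∂m := fun k => mul_nonneg zero_le_two (integral_nonneg (hF_nonneg k))
  have hc_summ : Summable fun k => 2 * ∫ q, F k q ∂m := by
    refine (hsumm.congr fun k => ?_).mul_left 2
    rw [hnorm_eq, hF_val]
  have hpt : ∀ q : ℝ, ENNReal.ofReal (Real.exp (δ * |q|)) ≤ ∑' k : ℕ, ENNReal.ofReal (2 * F k q) := by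
    intro q
    have h2 : HasSum (fun k => 2 * F k q) (2 * Real.cosh (δ * q)) := (hcosh_pt q).mul_left 2
    rw [← ENNReal.ofReal_tsum_of_nonneg (fun k => mul_nonneg zero_le_two (hF_nonneg k q)) h2.summable, h2.tsum_eq]
    refine ENNReal.ofReal_le_ofReal ?_
    have h1 : Real.cosh (δ * q) = Real.cosh (δ * |q|) := by
      rw [← Real.cosh_abs (δ * q), abs_mul, abs_of_pos hδ]
    rw [h1, Real.cosh_eq]
    have := Real.exp_pos (-(δ * |q|))
    linarith
  have hterm_meas : ∀ k : ℕ, AEMeasurable (fun q : ℝ => ENNReal.ofReal (2 * F k q)) m :=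
    fun k => ((hF_int k).const_mul 2).aestronglyMeasurable.aemeasurable.ennreal_ofReal
  have hlin : ∫⁻ q, ENNReal.ofReal (Real.exp (δ * |q|)) ∂m ≤ ENNReal.ofReal (∑' k, 2 * ∫ q, F k q ∂m) := by
    refine (lintegral_mono fun q => hpt q).trans (le_of_eq ?_)
    rw [lintegral_tsum hterm_meas, ENNReal.ofReal_tsum_of_nonneg hc_nonneg hc_summ]
    refine tsum_congr fun k => ?_
    rw [← ofReal_integral_eq_lintegral_ofReal ((hF_int k).const_mul 2)
      (ae_of_all _ fun q => mul_nonneg zero_le_two (hF_nonneg k q)), integral_const_mul]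
  have hmeas_exp : AEStronglyMeasurable (fun q : ℝ => Real.exp (δ * |q|)) m :=
    Continuous.aestronglyMeasurable (by fun_prop)
  exact ⟨hmeas_exp, (hasFiniteIntegral_iff_ofReal (ae_of_all _ fun q => (Real.exp_pos _).le)).2
    (hlin.trans_lt ENNReal.ofReal_lt_top)⟩

end Summit.QuantumFields.YangMills.Theorems.F4SubCurvatureDoorForwardConeLukacs

end
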